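import Literature.Probability.RandomPlanarGeometry.HalfPlaneFillProofs
import Literature.Probability.RandomPlanarGeometry.RestrictionHulls
import HarnessLib

/-!
# Crux `SAWDevelopingMap.ObservableToSLE` (stmt-CriticalPhenomena-10472), line `six-class-type-ladder`,
stub T2b′ `stub_carvedReduction_squeeze`: piece (G3″), THE `*`-HULL OF A SUBDOMAIN OF `ℍ` AND THE
COMPONENT-KERNEL HYPOTHESIS OF A RELATIVELY CLOSED SUBDOMAIN

Landing target:
`Summits/CriticalPhenomena/SAWScalingLimit/Theorems/SAWDevelopingMapObservableToSLETypeLadderCarvedReductionSqueezeHull.lean`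
(`--supports stmt-CriticalPhenomena-10472`; registered sub-goal `stub_carvedReduction_hullOfDomain`).

Two pieces of point-set bookkeeping for the outer side of the moving-carving squeeze:

* `stub_carvedReduction_hullOfDomain` — for an open connected `U ⊆ ℍ` containing a half-disc at
  `0` and the far part `{|z| ≥ R}` of `ℍ`, with `(ℍ ∖ U) ∪ {im ≤ 0}` connected (every removed
  piece attached to the boundary), `A := cl(ℍ ∖ U)` is a `*`-hull with `ℍ ∖ A = U` and
  `A ∩ ℍ = ℍ ∖ U` (so the limit carving `M̂ = φ_E(U)`, which is NOT a Jordan hull subdomain,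
  still has a hull to which `stub_carvedReduction_outerHull/kernelComponent/collarDeriv` apply);
* `subset_of_relClosed` / `componentKernel_of_relClosed` — if `U ⊆ V` is relatively closed in
  `interior V` (e.g. a connected component of it: `componentKernel_of_component`), every open
  preconnected `W ⊆ V` meeting `U` lies in `U`: the hypothesis of
  `stub_carvedReduction_kernelComponent` for `V = ⋂ₙ (ℍ ∖ A_n)`.
-/

noncomputable section

open Set Filter Topology Metric Bornology Function Complex
open UpperHalfPlane (upperHalfPlaneSet isOpen_upperHalfPlaneSet)
open Literature.Probability.RandomPlanarGeometry

namespace Summit.CriticalPhenomena.SAWScalingLimit.Theorems.ObservableToSLE.TypeLadder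

/-! ### The component-kernel hypothesis -/

/-- If `U ⊆ V` is relatively closed in `interior V`, every open preconnected `W ⊆ V` meeting `U`
lies in `U`. -/
theorem subset_of_relClosed {U V W : Set ℂ} (hUo : IsOpen U)
    (hcl : closure U ∩ interior V ⊆ U) (hWo : IsOpen W) (hWc : IsPreconnected W) (hWV : W ⊆ V)
    (hWU : (W ∩ U).Nonempty) : W ⊆ U := by
  have hWint : W ⊆ interior V := interior_maximal hWV hWo
  -- `W ∩ U` and `W ∖ closure U` are disjoint open sets covering `W`
  have hcover : W ⊆ U ∪ (closure U)ᶜ := fun z hz ↦ by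
    by_cases h : z ∈ closure U
    · exact Or.inl (hcl ⟨h, hWint hz⟩)
    · exact Or.inr h
  have hdisj : Disjoint U (closure U)ᶜ :=
    Set.disjoint_left.2 fun z hz h ↦ h (subset_closure hz)
  exact hWc.subset_left_of_subset_union hUo isClosed_closure.isOpen_compl hdisj hcover hWU

/-- The component-kernel hypothesis of `stub_carvedReduction_kernelComponent` for a subdomain
`ℍ ∖ A` which is relatively closed in the open kernel `int ⋂ₙ (ℍ ∖ A_n)`. -/
theorem componentKernel_of_relClosed {A : Set ℂ} {An : ℕ → Set ℂ} (hUo : IsOpen (upperHalfPlaneSet \ A))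
    (hcl : closure (upperHalfPlaneSet \ A) ∩ interior (⋂ n, upperHalfPlaneSet \ An n) ⊆
      upperHalfPlaneSet \ A) :
    ∀ W : Set ℂ, IsOpen W → IsPreconnected W → W ⊆ ⋂ n, upperHalfPlaneSet \ An n →
      (W ∩ (upperHalfPlaneSet \ A)).Nonempty → W ⊆ upperHalfPlaneSet \ A :=
  fun _ hWo hWc hWV hWU ↦ subset_of_relClosed hUo hcl hWo hWc hWV hWU

/-- A connected component of an open set is relatively closed in it (and open): the
component-kernel hypothesis for `U` = the component of `x` in `interior V`. -/
theorem componentKernel_of_component {V : Set ℂ} {x : ℂ} :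
    ∀ W : Set ℂ, IsOpen W → IsPreconnected W → W ⊆ V →
      (W ∩ connectedComponentIn (interior V) x).Nonempty → W ⊆ connectedComponentIn (interior V) x := by
  intro W hWo hWc hWV ⟨z, hzW, hzC⟩
  have hWint : W ⊆ interior V := interior_maximal hWV hWo
  have hzC' : connectedComponentIn (interior V) x = connectedComponentIn (interior V) z :=
    connectedComponentIn_eq hzC
  rw [hzC']
  exact hWc.subset_connectedComponentIn hzW hWint

/-! ### The `*`-hull of a subdomain of `ℍ` -/

/-- **Registered sub-goal `stub_carvedReduction_hullOfDomain`** (crux item stmt-CriticalPhenomena-10472,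
stub T2b′ `stub_carvedReduction_squeeze`, piece (G3″) HULL OF A SUBDOMAIN): let `U ⊆ ℍ` be open
and connected, containing the half-disc `ℍ ∩ B(0, r)` (`r > 0`) and every `z ∈ ℍ` with
`‖z‖ ≥ R`, and such that `(ℍ ∖ U) ∪ {im ≤ 0}` is connected.  Then `A := cl(ℍ ∖ U)` is a `*`-hull,
`ℍ ∖ A = U` and `A ∩ ℍ = ℍ ∖ U`. [cite: LawlerSchrammWerner2003Restriction, §2 p. 8 (𝒬*)] -/
theorem stub_carvedReduction_hullOfDomain :
    ∀ (U : Set ℂ) (r R : ℝ), IsOpen U → IsConnected U → U ⊆ upperHalfPlaneSet → 0 < r →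
      upperHalfPlaneSet ∩ ball 0 r ⊆ U → (∀ z ∈ upperHalfPlaneSet, R ≤ ‖z‖ → z ∈ U) →
      IsConnected ((upperHalfPlaneSet \ U) ∪ {z : ℂ | z.im ≤ 0}) →
      IsStarHull (closure (upperHalfPlaneSet \ U)) ∧
        upperHalfPlaneSet \ closure (upperHalfPlaneSet \ U) = U ∧
        closure (upperHalfPlaneSet \ U) ∩ upperHalfPlaneSet = upperHalfPlaneSet \ U := by
  intro U r R hUo hUc hUH hr hball hfar hconn
  set A : Set ℂ := closure (upperHalfPlaneSet \ U) with hA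
  -- `A ∩ ℍ = ℍ ∖ U`
  have hAH : A ∩ upperHalfPlaneSet = upperHalfPlaneSet \ U := by
    refine Subset.antisymm ?_ (fun z hz ↦ ⟨subset_closure hz, hz.1⟩)
    rintro z ⟨hzA, hzH⟩
    refine ⟨hzH, fun hzU ↦ ?_⟩
    rw [hA, mem_closure_iff_nhds] at hzA
    obtain ⟨w, hwU, hw⟩ := hzA U (hUo.mem_nhds hzU)
    exact hw.2 hwU
  -- `ℍ ∖ A = U`
  have hHA : upperHalfPlaneSet \ A = U := by
    ext z
    constructor
    · rintro ⟨hzH, hzA⟩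
      by_contra hzU
      exact hzA (subset_closure ⟨hzH, hzU⟩)
    · intro hzU
      refine ⟨hUH hzU, fun hzA ↦ ?_⟩
      have : z ∈ A ∩ upperHalfPlaneSet := ⟨hzA, hUH hzU⟩
      rw [hAH] at this
      exact this.2 hzU
  -- bounded
  have hbdd : IsBounded A := by
    refine (isBounded_closedBall (x := (0 : ℂ)) (r := R)).subset ?_
    rw [hA]
    refine closure_minimal (fun z hz ↦ ?_) isClosed_closedBall
    rw [mem_closedBall, dist_zero_right]
    by_contra hlt
    push Not at hlt
    exact hz.2 (hfar z hz.1 hlt.le)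
  -- `0 ∉ A`
  have h0 : (0 : ℂ) ∉ A := by
    rw [hA, mem_closure_iff_nhds]
    intro h
    obtain ⟨w, hw, hwU⟩ := h (ball 0 r) (ball_mem_nhds 0 hr)
    exact hwU.2 (hball ⟨hwU.1, hw⟩)
  -- simple connectivity of `ℍ ∖ A = U`
  have hcompl : Uᶜ = (upperHalfPlaneSet \ U) ∪ {z : ℂ | z.im ≤ 0} := by
    ext z
    simp only [mem_compl_iff, mem_union, Set.mem_sdiff, mem_setOf_eq]
    constructor
    · intro hzU
      by_cases hz : 0 < z.im
      · exact Or.inl ⟨hz, hzU⟩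
      · exact Or.inr (not_lt.1 hz)
    · rintro (⟨-, hzU⟩ | hz) hzU'
      · exact hzU hzU'
      · exact absurd (hUH hzU' : 0 < z.im) (not_lt.2 hz)
  have hunb : ¬ IsBounded Uᶜ := by
    intro hb
    obtain ⟨C, hC⟩ := hb.subset_closedBall 0
    have hmem : (-((|C| + 1 : ℝ) : ℂ) * I) ∈ Uᶜ := by
      rw [hcompl]
      refine Or.inr ?_
      show (-((|C| + 1 : ℝ) : ℂ) * I).im ≤ 0
      have : -1 ≤ |C| := by linarith [abs_nonneg C]
      simpa using this
    have := hC hmem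
    rw [mem_closedBall, dist_zero_right, norm_mul, norm_neg, norm_real, norm_I, mul_one,
      Real.norm_of_nonneg (by positivity)] at this
    linarith [le_abs_self C]
  have hsc : IsSimplyConnected (upperHalfPlaneSet \ A) := by
    rw [hHA]
    refine isSimplyConnected_of_isConnected_compl_holds hUo hUc ?_ hunb
    rw [hcompl]; exact hconn
  have hclos : closure (A ∩ upperHalfPlaneSet) = A := by
    rw [hAH]
  exact ⟨⟨⟨hbdd, hclos, hsc⟩, h0⟩, hHA, hAH⟩

end Summit.CriticalPhenomena.SAWScalingLimit.Theorems.ObservableToSLE.TypeLadder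

end
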